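/-
# The Wolff-packing model: exact lattice cancellation inside the zero-side class

(rh-split cell, seat rh-split-screw-bridge g13, 2026-08-27; kernel scratch for card
`cards/SPLIT-screw-bridge.md` §18, barrier candidate B16.)  Nothing in this file is a claim about the
truth of RH; no declaration mentions `ζ`.
-/
import Mathlib.Analysis.SpecialFunctions.Complex.Log
import Mathlib.Analysis.Complex.Trigonometric
import Mathlib.Analysis.Normed.Group.InfiniteSum
import Mathlib.Topology.Algebra.InfiniteSum.Real
import HarnessLib
/-!
CARVE NOTE (author rh-split-screw-bridge g13, lead RULING #161 (3)–(4), 2026-08-27): PART A of the three-part carve of the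
frozen object `HOME/rh-split-screw-bridge/g13/ScrewLatticeWolff.lean` (sha16 14a22eecb442a4a4, 637 l) at the author-named
boundaries «## 3.» (the section banner at source l. 223) and «## 4.» (source l. 389).  PART A = source ll. 1–12 (title comment + imports,
above this note) and source ll. 13–222 (module docstring, preamble, §1 `quadTerm…`, §2 `exists_tuning`) reproduced
BYTE-IDENTICALLY below this note, then the namespace is closed.  PART B (`…ScrewLatticeWolffB`, §3 Gram / negative-definite
lemmas = source ll. 223–388) imports A; PART C (`…ScrewLatticeWolffC`, §§4–6 the model on the lattice incl.
`modelPsi_latticePSD` = source ll. 389–637) imports B.  The namespace `…Splittings.ScrewLatticeWolff` is re-opened in B and C,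
so every fully-qualified name is the refereed one (ref-2 g3 PART 1, probe d7696209ca1223c6: 29/29 ⊆ std axioms).  No
statement, proof or docstring byte of the source is changed by the carve.  Nothing here bears on the truth of RH.
-/


/-!
# The Wolff-packing model (barrier candidate B16 «WOLFF PACKING ⟂ LATTICE METHODS»)

THE CLASS (card §17(5)).  A *zero-side configuration* is a family of quadruples
`q = {1/2 ± σ_q ± iγ_q}` (`0 < σ_q < 1/2`, `γ_q > 14`) with weights `m_q > 0`, `Σ_q m_q/γ_q² < ∞`; its
*model screw function* is Suzuki's series `Ψ_Z(t) = Σ_ρ m_ρ (cosh(κ_ρ t) - 1)/κ_ρ²` (`κ_ρ = ρ - 1/2`), i.e.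
`Ψ_Z(t) = Σ_q T_q(t)` with the quadruple term `T_q(t) = 4 m_q Re[(cosh(κ_q t) - 1)/κ_q²]`, `κ_q = σ_q + iγ_q`
(`quadTerm`; `quadTerm_eq_sum_four` checks that it is the sum of the four terms of Suzuki's series).

THE MODEL.  Fix `h > 0`.  The *atom* of a quadruple is `a_q = e^{κ_q h}` (`|a_q| = e^{σ_q h} > 1`); on the
lattice, `T_q(k h) = 2 m Re[a^k/κ²] + 2 m Re[a^{-k}/κ²] - 4 m Re[1/κ²]` (`quadTerm_lattice`): the sampled
series only sees the atoms, not the ordinates (aliasing `γ ↦ γ + 2π/h`).  WOLFF DATA: points `w_i` with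
`1 < |w_i| ≤ R` and weights `α_i > 0`, `Σ α_i < ∞`, such that

  `Σ_i α_i w_i^k = 0` for every integer `k ≥ 1`.                                            (W)

Such data exist with `{w_i}` = the centres and `α_i` = the areas of the discs of any full packing of the
annulus `{1 < |z| < R}` by disjoint closed discs (area mean value property of `z^k` on each disc,
`∫_annulus z^k dA = 0`, null residual set) — J. Wolff's 1921 example of a Borel series `Σ α_i/(z - w_i)`
vanishing identically near `∞`/`0` [Ross–Shapiro, *Generalized analytic continuation*, AMS ULS 25, §4.2,
Lemma 4.2.4 and the display before Thm 4.2.5]; existence is NOT formalised here (it is hypothesis `hW`).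
For each `i` put one quadruple at the atom `w_i` and one at `conj w_i` (`e^{κ₁ h} = w_i`, `e^{κ₂ h} = conj w_i`:
ordinates `γ = (±arg w_i + 2πN)/h`, any aliases `N` making `γ > 14`) with weights TUNED so that
`m₁/κ₁² + m₂/conj(κ₂)² = -λ α_i` (`0 < λ`; solvable with `m₁, m₂ > 0` because `Im(1/κ₁²) < 0 < Im(1/conj(κ₂)²)`
and both real parts are negative — `exists_tuning`).  THEN (this file, RH-free, sorry-free):

* `pairTerm_lattice`: the two quadruples of atom-pair `i` contribute `2λ α_i (2 - Re w_i^k - Re w_i^{-k})` at `k h`;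
* `modelPsi_lattice`: by (W), for `k ≥ 1`, `Ψ_Z(k h) = 2λ (2A - B_k)`, `A = Σ α_i`, `B_k = Σ α_i Re w_i^{-k}`,
  `|B_k| ≤ A`; hence the UNIFORM TWO-SIDED LATTICE BOUNDS `2λA ≤ Ψ_Z(k h) ≤ 6λA` (`modelPsi_lattice_floor`,
  `modelPsi_lattice_ceiling`): `LAT(h)` with a positive floor, bounded lattice values, no decay;
* §5 `modelPsi_latticePSD`: the Kreĭn–Suzuki kernel `Ψ_Z(s) + Ψ_Z(t) - Ψ_Z(s - t)` of the model is NON-NEGATIVE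
  DEFINITE on the lattice `h ℕ` (`LPSD(h)` of card §18 / `ScrewLatticePSD`): `k ↦ Ψ_Z(k h)` is
  `2λA·[k ≠ 0] + 2λ Σ_i α_i (1 - Re u_i^{|k|})`, `u_i = w_i^{-1}` (`modelPsi_lattice_negdef`; `[k ≠ 0] = 1 - Re 0^k`),
  a negative definite sequence: §3 proves `Σ_{a,b} (g(p_a) + g(p_b) - g(|p_a - p_b|)) x_a x_b ≥ 0` for
  `g(k) = 1 - Re u^k`, `|u| ≤ 1`, by the finite Gram identity `Re u^{|p-q|} = Re G_L(p,q)`,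
  `G_L(p,q) = (1 - |u|²) Σ_{n<L} v_n(p) conj v_n(q) + v_L(p) conj v_L(q)`, `v_n(p) = u^{n-p} [p ≤ n]`
  (`gramKernel_re_eq`, `negdefForm_nonneg`; augmentation by the point `0` with weight `-Σ x`).

Meanwhile the real parts `1/2 + σ_q = 1/2 + log|w_i|/h` fill `(1/2, 1/2 + log R/h)` densely near the top
WITHOUT attaining the supremum whenever the `|w_i|` accumulate at `R` without reaching it (as packing centres
do): no zero-free strip `Re s > 1/2 + log R/h - ε` exists although every one- and two-sided lattice test and
the lattice kernel test are passed.  Inputs used by an argument that nevertheless concludes a strip from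
lattice data must therefore lie OUTSIDE the class: the prime side / Euler product, or a COHERENCE input on the
near-top zeros (Borel–Walsh–Gončar superconvergence, Beurling–Borichev–Hedenmalm, the Blaschke-type condition of
Ross–Shapiro Prop. 4.2.14, Brown–Shields–Zeller non-dominating atoms, Thm 4.2.12).  See the card for the census.

Weights are REAL positive here (the exact tuning needs it); §17's engine uses only `m > 0` and
`Σ m/|Im ρ|² < ∞`, never integrality.  Hygiene: no `sorry`, no new axioms, no instances, no notation, nothing
`private`.
-/

set_option linter.dupNamespace false

noncomputable section

open Complex Filter Topology Finset
open scoped ComplexConjugate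

namespace Summit.RiemannHypothesis.RiemannHypothesis.Theorems.Splittings.ScrewLatticeWolff

/-! ## 1. The quadruple term and its lattice samples -/

/-- The contribution of the quadruple `{1/2 ± σ ± iγ}` (`κ = σ + iγ`), each zero with weight `m`, to
Suzuki's series `Σ_ρ m_ρ (cosh(κ_ρ t) - 1)/κ_ρ²`: `T(t) = 4 m Re[(cosh(κ t) - 1)/κ²]`. -/
def quadTerm (m : ℝ) (κ : ℂ) (t : ℝ) : ℝ :=
  4 * m * ((Complex.cosh (κ * t) - 1) / κ ^ 2).re

/-- `quadTerm` is the sum of the four terms `κ' ∈ {κ, -κ, conj κ, -conj κ}` of Suzuki's series. -/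
theorem quadTerm_eq_sum_four (m : ℝ) (κ : ℂ) (t : ℝ) :
    (quadTerm m κ t : ℂ) =
      m * ((Complex.cosh (κ * t) - 1) / κ ^ 2) + m * ((Complex.cosh (-κ * t) - 1) / (-κ) ^ 2) +
        m * ((Complex.cosh (conj κ * t) - 1) / (conj κ) ^ 2) +
          m * ((Complex.cosh (-conj κ * t) - 1) / (-conj κ) ^ 2) := by
  have h1 : Complex.cosh (-κ * t) = Complex.cosh (κ * t) := by rw [neg_mul, Complex.cosh_neg]
  have h2 : Complex.cosh (-conj κ * t) = Complex.cosh (conj κ * t) := by rw [neg_mul, Complex.cosh_neg]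
  have h3 : Complex.cosh (conj κ * t) = conj (Complex.cosh (κ * t)) := by
    rw [← Complex.cosh_conj, map_mul, Complex.conj_ofReal]
  have h4 : m * ((Complex.cosh (conj κ * t) - 1) / (conj κ) ^ 2) =
      conj (m * ((Complex.cosh (κ * t) - 1) / κ ^ 2)) := by
    rw [h3]; simp [map_div₀, map_pow]
  rw [h1, h2, neg_sq, neg_sq, h4, quadTerm]
  set z : ℂ := m * ((Complex.cosh (κ * t) - 1) / κ ^ 2) with hz
  have hre : (4 * m * ((Complex.cosh (κ * t) - 1) / κ ^ 2).re : ℝ) = 4 * z.re := by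
    rw [hz, Complex.re_ofReal_mul]; ring
  rw [hre]
  apply Complex.ext
  all_goals simp
  all_goals ring

/-- `quadTerm` is even in `t`. -/
theorem quadTerm_neg (m : ℝ) (κ : ℂ) (t : ℝ) : quadTerm m κ (-t) = quadTerm m κ t := by
  simp only [quadTerm, Complex.ofReal_neg, mul_neg, Complex.cosh_neg]

/-- `quadTerm` vanishes at `t = 0`. -/
theorem quadTerm_zero (m : ℝ) (κ : ℂ) : quadTerm m κ 0 = 0 := by
  simp [quadTerm]

/-- LATTICE SAMPLES SEE ONLY THE ATOM: if `e^{κ h} = w` then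
`T(k h) = 2 m Re[w^k/κ²] + 2 m Re[w^{-k}/κ²] - 4 m Re[1/κ²]` for every `k ∈ ℕ`. -/
theorem quadTerm_lattice (m h : ℝ) {κ w : ℂ} (hw : Complex.exp (κ * h) = w) (k : ℕ) :
    quadTerm m κ (k * h) =
      2 * m * (w ^ k / κ ^ 2).re + 2 * m * ((w ^ k)⁻¹ / κ ^ 2).re - 4 * m * (1 / κ ^ 2).re := by
  have e1 : Complex.exp (κ * ((k : ℝ) * h : ℝ)) = w ^ k := by
    rw [← hw, ← Complex.exp_nat_mul]; congr 1; push_cast; ring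
  have e2 : Complex.exp (-(κ * ((k : ℝ) * h : ℝ))) = (w ^ k)⁻¹ := by rw [Complex.exp_neg, e1]
  have hcosh : Complex.cosh (κ * ((k : ℝ) * h : ℝ)) = (w ^ k + (w ^ k)⁻¹) / 2 := by
    rw [← e2, ← e1, ← Complex.two_cosh]; ring
  unfold quadTerm
  rw [hcosh]
  have key : (4 * m : ℝ) * (((w ^ k + (w ^ k)⁻¹) / 2 - 1) / κ ^ 2).re =
      (((4 * m : ℝ) : ℂ) * (((w ^ k + (w ^ k)⁻¹) / 2 - 1) / κ ^ 2)).re := by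
    rw [Complex.re_ofReal_mul]
  have key2 : ((4 * m : ℝ) : ℂ) * (((w ^ k + (w ^ k)⁻¹) / 2 - 1) / κ ^ 2) =
      ((2 * m : ℝ) : ℂ) * (w ^ k / κ ^ 2) + ((2 * m : ℝ) : ℂ) * ((w ^ k)⁻¹ / κ ^ 2) -
        ((4 * m : ℝ) : ℂ) * (1 / κ ^ 2) := by
    push_cast; ring
  rw [key, key2, Complex.sub_re, Complex.add_re, Complex.re_ofReal_mul, Complex.re_ofReal_mul,
    Complex.re_ofReal_mul]

/-! ## 2. An atom pair with tuned weights -/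

/-- Real parts are invariant under conjugation of the argument (bookkeeping). -/
theorem re_eq_re_conj (z : ℂ) : z.re = (conj z).re := (Complex.conj_re z).symm

/-- **THE TUNED PAIR.**  One quadruple at the atom `w` (`e^{κ₁ h} = w`, weight `m₁`) and one at `conj w`
(`e^{κ₂ h} = conj w`, weight `m₂`), tuned by `m₁/κ₁² + m₂/(conj κ₂)² = -(λ α)`, contribute
`2 λ α (2 - Re w^k - Re w^{-k})` at the lattice point `k h`. -/
theorem pairTerm_lattice {m₁ m₂ h lam α : ℝ} {κ₁ κ₂ w : ℂ} (hw₁ : Complex.exp (κ₁ * h) = w)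
    (hw₂ : Complex.exp (κ₂ * h) = conj w)
    (htune : (m₁ : ℂ) / κ₁ ^ 2 + (m₂ : ℂ) / (conj κ₂) ^ 2 = -((lam * α : ℝ) : ℂ)) (k : ℕ) :
    quadTerm m₁ κ₁ (k * h) + quadTerm m₂ κ₂ (k * h) =
      2 * lam * α * (2 - (w ^ k).re - ((w ^ k)⁻¹).re) := by
  rw [quadTerm_lattice m₁ h hw₁ k, quadTerm_lattice m₂ h hw₂ k]
  -- move the conjugate atom onto the conjugate `κ₂`
  have c1 : ((conj w) ^ k / κ₂ ^ 2).re = (w ^ k / (conj κ₂) ^ 2).re := by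
    rw [re_eq_re_conj (w ^ k / (conj κ₂) ^ 2)]; simp [map_pow]
  have c2 : (((conj w) ^ k)⁻¹ / κ₂ ^ 2).re = ((w ^ k)⁻¹ / (conj κ₂) ^ 2).re := by
    rw [re_eq_re_conj ((w ^ k)⁻¹ / (conj κ₂) ^ 2)]; simp [map_pow]
  have c3 : (1 / κ₂ ^ 2).re = (1 / (conj κ₂) ^ 2).re := by
    rw [re_eq_re_conj (1 / (conj κ₂) ^ 2)]; simp [map_pow]
  rw [c1, c2, c3]
  -- name the pieces and compute with real and imaginary parts
  set A : ℂ := w ^ k with hA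
  set B : ℂ := (w ^ k)⁻¹ with hB
  set C₁ : ℂ := (κ₁ ^ 2)⁻¹ with hC₁
  set C₂ : ℂ := ((conj κ₂) ^ 2)⁻¹ with hC₂
  have ht : (m₁ : ℂ) * C₁ + (m₂ : ℂ) * C₂ = -((lam * α : ℝ) : ℂ) := by
    rw [hC₁, hC₂, ← div_eq_mul_inv, ← div_eq_mul_inv]; exact htune
  have htre : m₁ * C₁.re + m₂ * C₂.re = -(lam * α) := by
    have := congrArg Complex.re ht
    simpa [Complex.add_re, Complex.re_ofReal_mul, Complex.neg_re, Complex.ofReal_re] using this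
  have htim : m₁ * C₁.im + m₂ * C₂.im = 0 := by
    have := congrArg Complex.im ht
    simpa [Complex.add_im, Complex.im_ofReal_mul, Complex.neg_im, Complex.ofReal_im] using this
  simp only [div_eq_mul_inv, one_mul]
  rw [← hC₁, ← hC₂]
  simp only [Complex.mul_re]
  linear_combination (2 * A.re + 2 * B.re - 4) * htre - (2 * A.im + 2 * B.im) * htim

/-- **TUNING IS POSSIBLE** with positive weights: for `0 < σ < γ₁`, `0 < σ < γ₂` (`κⱼ = σ + iγⱼ`) and a
target `-c < 0` there are `m₁, m₂ > 0` with `m₁/κ₁² + m₂/(conj κ₂)² = -c`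
(`Im(1/κ₁²) < 0 < Im(1/(conj κ₂)²)`, both real parts `< 0`). -/
theorem exists_tuning {σ γ₁ γ₂ c : ℝ} (hσ : 0 < σ) (h₁ : σ < γ₁) (h₂ : σ < γ₂) (hc : 0 < c) :
    ∃ m₁ m₂ : ℝ, 0 < m₁ ∧ 0 < m₂ ∧
      (m₁ : ℂ) / ((σ : ℂ) + γ₁ * I) ^ 2 + (m₂ : ℂ) / (conj ((σ : ℂ) + γ₂ * I)) ^ 2 = -(c : ℂ) := by
  -- `1/κ₁² = (σ² - γ₁² - 2σγ₁ i)/|κ₁|⁴`, `1/conj(κ₂)² = (σ² - γ₂² + 2σγ₂ i)/|κ₂|⁴`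
  have hγ₁ : 0 < γ₁ := hσ.trans h₁
  have hγ₂ : 0 < γ₂ := hσ.trans h₂
  set n₁ : ℝ := σ ^ 2 + γ₁ ^ 2 with hn₁
  set n₂ : ℝ := σ ^ 2 + γ₂ ^ 2 with hn₂
  have hn₁0 : 0 < n₁ := by positivity
  have hn₂0 : 0 < n₂ := by positivity
  -- unnormalised solution of the imaginary-part equation: `m₁ ∝ γ₂ n₁²`, `m₂ ∝ γ₁ n₂²`
  set D : ℝ := γ₂ * (γ₁ ^ 2 - σ ^ 2) + γ₁ * (γ₂ ^ 2 - σ ^ 2) with hD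
  have hD0 : 0 < D := by
    have : 0 < γ₁ ^ 2 - σ ^ 2 := by nlinarith
    have : 0 < γ₂ ^ 2 - σ ^ 2 := by nlinarith
    positivity
  refine ⟨c * γ₂ * n₁ ^ 2 / D, c * γ₁ * n₂ ^ 2 / D, by positivity, by positivity, ?_⟩
  have hκ₁ : ((σ : ℂ) + γ₁ * I) ^ 2 ≠ 0 := by
    apply pow_ne_zero
    intro h0
    have := congrArg Complex.im h0
    simp at this
    linarith
  have hκ₂ : (conj ((σ : ℂ) + γ₂ * I)) ^ 2 ≠ 0 := by
    apply pow_ne_zero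
    intro h0
    have := congrArg Complex.im h0
    simp at this
    linarith
  rw [div_add_div _ _ hκ₁ hκ₂, div_eq_iff (mul_ne_zero hκ₁ hκ₂)]
  have hDne : D ≠ 0 := hD0.ne'
  apply Complex.ext
  · simp only [Complex.add_re, Complex.mul_re, Complex.mul_im, Complex.neg_re, Complex.neg_im,
      Complex.ofReal_re, Complex.ofReal_im]
    simp only [sq, Complex.mul_re, Complex.mul_im, Complex.add_re, Complex.add_im, Complex.ofReal_re,
      Complex.ofReal_im, Complex.I_re, Complex.I_im, Complex.conj_re, Complex.conj_im]
    field_simp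
    rw [hD, hn₁, hn₂]
    ring
  · simp only [Complex.add_im, Complex.mul_re, Complex.mul_im, Complex.neg_re, Complex.neg_im,
      Complex.ofReal_re, Complex.ofReal_im]
    simp only [sq, Complex.mul_re, Complex.mul_im, Complex.add_re, Complex.add_im, Complex.ofReal_re,
      Complex.ofReal_im, Complex.I_re, Complex.I_im, Complex.conj_re, Complex.conj_im]
    field_simp
    rw [hD, hn₁, hn₂]
    ring

end Summit.RiemannHypothesis.RiemannHypothesis.Theorems.Splittings.ScrewLatticeWolff

end
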